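import Literature.Probability.LatticeModels.CriticalTwoPointDCPLower
import Literature.Probability.LatticeModels.CriticalTwoPointBounds
import Literature.Probability.LatticeModels.TwoPointLogConvex
import HarnessLib

/-!
# Duminil-Copin–Panis 2025, Theorem 1.3 at `β_c` from Theorem 1.2 at `β_c` (the printed deduction, proved)

Topic `Literature/Probability/LatticeModels`; family `crit-ising`. No named fact, no `sorry`.

H. Duminil-Copin, R. Panis, *New lower bounds for the (near) critical Ising and φ⁴ models' two-point
functions*, CMP 406 (2025) = arXiv:2404.05700, prove their pointwise bound **Theorem 1.3**
(`dcp_criticalTwoPoint_axis_lower` of `CriticalTwoPointDCPLower.lean`, vendored at `β = β_c`) FROM the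
main inequality **Theorem 1.2** (`dcp_reflectedGradient_lower`, ibid., a named fact of the tree) in
half a page (arXiv v2, p. 5, "Proof of Theorem 1.3"): split the sum of Theorem 1.2 at `x₁ = n/2`;
the part `x₁ ≤ n/2` is `≤ χ_n(β) ⟨τ₀τ_{(n/4)e₁}⟩` by the Messager–Miracle-Solé (MMS) inequalities;
the part `x₁ > n/2` is controlled by the **gradient estimate** (the second display of the printed
proof, "using the spectral representation of these models and the MMS inequalities, we obtain the
following gradient estimate"; the module docstring of `CriticalTwoPointDCPLower.lean` calls it
(1.11)) `⟨τ₀τ_x⟩ - ⟨τ₀τ_{𝓡_n(x)}⟩ ≤ C₁ (|x - 𝓡_n(x)|/n) ⟨τ₀τ_{(n/4)e₁}⟩`, itself a consequence of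
the spectral representation (footnote to that display, after Aizenman–Duminil-Copin 2021,
Prop. 5.9) and MMS.

This file proves that deduction at `β = β_c`, `d ≥ 3`:

* `dcp_criticalTwoPoint_axis_lower_of_reflectedGradient_lower :
    dcp_reflectedGradient_lower → dcp_criticalTwoPoint_axis_lower`.

Every other input is a theorem of the tree: the MMS inequalities for the plus state
(`messager_miracleSole_holds`, `twoPointPlus_le_axis_of_mem_sphere`), `μ⁺_{β_c} = μ^f_{β_c}` on pairs
and `m*(β_c) = 0` for `d ≥ 3` (`twoPointPlus_criticalBeta_eq_twoPointFree_holds`,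
`plusPair_eq_freePair_of_lroTildeSq_holds`, `spontaneousMagnetization_criticalBeta_eq_zero_holds`,
Aizenman–Duminil-Copin–Sidoravicius 2015), translation invariance of the plus state
(`plusPair_eq_twoPointPlus_sub`), the lower bound `⟨σ₀σ_x⟩_{β_c} ≥ c‖x‖^{1-d}`
(`criticalTwoPoint_lower`, used only through `⟨σ₀σ_{e₁}⟩_{β_c} > 0` and `⟨σ₀σ_{ke₁}⟩_{β_c} > 0`), and
the log-convexity of `k ↦ ⟨σ₀σ_{ke₁}⟩ + ⟨σ₀σ_{x_⊥+ke₁}⟩` (`twoPointPlus_axisPair_sq_le`,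
`TwoPointLogConvex.lean`, the tree's form of the spectral representation), from which the gradient
estimate is derived here (`DCP.gradient_estimate`) as in its footnote in the source /
ADC 2021 Prop. 5.9: for a positive, nonincreasing, log-convex sequence `w`,
`w_k - w_{k+1} ≤ w_m/(k-m+1)` (`DCP.sub_succ_le_of_logConvex`), then telescope.

Deviations from the printed proof (bookkeeping only): we apply Theorem 1.2 at scale `N = 4n` and
bound everything by `⟨τ₀τ_{ne₁}⟩` (the source applies it at scale `n` and bounds by
`⟨τ₀τ_{(n/4)e₁}⟩`); the finitely many terms next to the reflection hyperplane (where
`⟨τ_yτ_{𝓡_N(y)}⟩ = ⟨τ₀τ₀⟩ = 1`) are absorbed using `⟨τ₀τ_{e₁}⟩_{β_c} > 0`, a constant depending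
only on `d` (the source's constants `C₃, C₄` silently do the same). The module docstring of
`CriticalTwoPointDCPLower.lean` refers to a file `TwoPointGradientEstimate.lean` for it; no such
file exists in the tree — the estimate is proved here instead.

## References

* H. Duminil-Copin, R. Panis, CMP 406 (2025), arXiv:2404.05700, Thm. 1.2, Thm. 1.3 and its proof,
  the gradient estimate with its footnote (p. 5 of the arXiv version, held:
  `paper:arxiv-2404.05700`, p0005)
  [DuminilCopinPanis2025LowerBounds].
* M. Aizenman, H. Duminil-Copin, Ann. of Math. 194 (2021), arXiv:1912.07973, Prop. 5.9 (gradient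
  estimate from the spectral representation) [AizenmanDuminilCopinAnnals2021].
* A. Messager, S. Miracle-Solé, J. Stat. Phys. 17 (1977) 245–262 [MessagerMiracleSoleJSP1977].

## Mathlib

`geom_sum_mul_neg`, `pow_le_pow_of_le_one`, `div_le_div_iff_of_pos`, `Finset.sum_ite`,
`Finset.sum_filter`, `Finset.sum_fiberwise_of_maps_to`, `Fintype.card_filter_piFinset_const_eq_of_mem`,
`Finset.sum_image`, `Finset.sum_range_succ'`, `Finset.sum_eq_sum_Ico_succ_bot`.
-/

noncomputable section

open Finset Filter

namespace Literature.Probability.LatticeModels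

namespace DCP

/-! ### Part 1. Decrements of positive nonincreasing log-convex sequences -/

/-- `rᵃ(1 - r) ≤ 1/(a+1)` for `0 ≤ r ≤ 1`: `(a+1) rᵃ (1-r) ≤ (∑_{i≤a} rⁱ)(1-r) = 1 - r^{a+1} ≤ 1`
(the step "replacing `kλᵏ(1-λ)` by `C λ^{k/2}`" of Duminil-Copin–Panis 2025, footnote to the gradient
estimate, in the cruder form `kλᵏ(1-λ) ≤ 1`). [cite: DuminilCopinPanis2025LowerBounds, §1.1, proof of Theorem 1.3, footnote to the gradient estimate (p. 5)] -/
theorem pow_mul_one_sub_le {r : ℝ} (h0 : 0 ≤ r) (h1 : r ≤ 1) (a : ℕ) :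
    r ^ a * (1 - r) ≤ 1 / ((a : ℝ) + 1) := by
  have hgeom : (∑ i ∈ range (a + 1), r ^ i) * (1 - r) = 1 - r ^ (a + 1) :=
    geom_sum_mul_neg r (a + 1)
  have hsum : ((a : ℝ) + 1) * r ^ a ≤ ∑ i ∈ range (a + 1), r ^ i := by
    calc ((a : ℝ) + 1) * r ^ a = ∑ _i ∈ range (a + 1), r ^ a := by simp
      _ ≤ ∑ i ∈ range (a + 1), r ^ i := Finset.sum_le_sum fun i hi =>
          pow_le_pow_of_le_one h0 h1 (by rw [Finset.mem_range] at hi; omega)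
  have hpos : (0 : ℝ) < (a : ℝ) + 1 := by positivity
  rw [le_div_iff₀ hpos]
  have h1r : 0 ≤ 1 - r := sub_nonneg.2 h1
  calc r ^ a * (1 - r) * ((a : ℝ) + 1) = ((a : ℝ) + 1) * r ^ a * (1 - r) := by ring
    _ ≤ (∑ i ∈ range (a + 1), r ^ i) * (1 - r) := mul_le_mul_of_nonneg_right hsum h1r
    _ = 1 - r ^ (a + 1) := hgeom
    _ ≤ 1 := by linarith [pow_nonneg h0 (a + 1)]

/-- **Decrements of a positive, nonincreasing, log-convex sequence**: if `w_j > 0`, `w_{j+1} ≤ w_j`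
and `w_{j+1}² ≤ w_j w_{j+2}` for all `j`, then `w_k - w_{k+1} ≤ w_m / (k - m + 1)` for `m ≤ k`
(the ratios `r_j = w_{j+1}/w_j ≤ 1` are nondecreasing, so `w_k ≤ w_m r_k^{k-m}` and
`w_k - w_{k+1} = w_k(1 - r_k) ≤ w_m r_k^{k-m}(1-r_k) ≤ w_m/(k-m+1)`). This is the mechanism of the
gradient estimate of Duminil-Copin–Panis 2025 (footnote in the proof of Thm. 1.3) / Aizenman–
Duminil-Copin 2021, Prop. 5.9, with the spectral measure replaced by log-convexity. [cite: DuminilCopinPanis2025LowerBounds, §1.1, proof of Theorem 1.3, footnote to the gradient estimate (p. 5)] -/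
theorem sub_succ_le_of_logConvex (w : ℕ → ℝ) (hpos : ∀ j, 0 < w j)
    (hmono : ∀ j, w (j + 1) ≤ w j) (hconv : ∀ j, w (j + 1) ^ 2 ≤ w j * w (j + 2)) {m k : ℕ}
    (hmk : m ≤ k) : w k - w (k + 1) ≤ w m / ((k : ℝ) - m + 1) := by
  set r : ℕ → ℝ := fun j => w (j + 1) / w j with hr
  have hr0 : ∀ j, 0 ≤ r j := fun j => div_nonneg (hpos _).le (hpos _).le
  have hr1 : ∀ j, r j ≤ 1 := fun j => (div_le_one (hpos j)).2 (hmono j)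
  have hrmono : Monotone r := by
    refine monotone_nat_of_le_succ fun j => ?_
    change w (j + 1) / w j ≤ w (j + 1 + 1) / w (j + 1)
    rw [div_le_div_iff₀ (hpos j) (hpos (j + 1))]
    have h := hconv j
    nlinarith [h]
  have hstep : ∀ j, w (j + 1) = r j * w j := fun j =>
    (div_mul_cancel₀ (w (j + 1)) (hpos j).ne').symm
  have key : ∀ i, m + i ≤ k → w (m + i) ≤ w m * r k ^ i := by
    intro i
    induction i with
    | zero => intro _; simp
    | succ i ih =>
        intro hi
        have h1 := ih (by omega)
        calc w (m + (i + 1)) = r (m + i) * w (m + i) := by rw [← add_assoc]; exact hstep _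
          _ ≤ r k * (w m * r k ^ i) :=
              mul_le_mul (hrmono (by omega)) h1 (hpos _).le (hr0 _)
          _ = w m * r k ^ (i + 1) := by ring
  have hwk : w k ≤ w m * r k ^ (k - m) := by
    have := key (k - m) (by omega)
    rwa [Nat.add_sub_cancel' hmk] at this
  have h1r : 0 ≤ 1 - r k := sub_nonneg.2 (hr1 k)
  calc w k - w (k + 1) = w k * (1 - r k) := by rw [hstep k]; ring
    _ ≤ w m * r k ^ (k - m) * (1 - r k) := mul_le_mul_of_nonneg_right hwk h1r
    _ = w m * (r k ^ (k - m) * (1 - r k)) := by ring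
    _ ≤ w m * (1 / (((k - m : ℕ) : ℝ) + 1)) :=
        mul_le_mul_of_nonneg_left (pow_mul_one_sub_le (hr0 k) (hr1 k) _) (hpos m).le
    _ = w m / ((k : ℝ) - m + 1) := by rw [Nat.cast_sub hmk]; ring

/-- Telescoping a uniform bound on decrements: if `v_j - v_{j+1} ≤ B` for `a ≤ j < a + l` then
`v_a - v_{a+l} ≤ l B`. [folklore] -/
theorem sub_le_mul_of_sub_succ_le (v : ℕ → ℝ) (B : ℝ) (a : ℕ) :
    ∀ l : ℕ, (∀ j, a ≤ j → j < a + l → v j - v (j + 1) ≤ B) → v a - v (a + l) ≤ l * B := by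
  intro l
  induction l with
  | zero => intro _; simp
  | succ l ih =>
      intro h
      have h' := ih fun j hj hjb => h j hj (by omega)
      have hl := h (a + l) (by omega) (by omega)
      rw [show a + (l + 1) = a + l + 1 by ring]
      push_cast
      linarith

/-! ### Part 2. The critical two-point function of `ℤ^{d'+1}` along an axis

Throughout, `S x = ⟨σ₀σ_x⟩⁺_{β_c}` on `ℤ^{d'+1}` (local notation); for `d' + 1 ≥ 3` this is also the
free-state two-point function `twoPointFree` (`twoPointPlus_criticalBeta_eq_twoPointFree_holds`). -/

section Critical

variable {d' : ℕ}

set_option hygiene false in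
local notation "S" => twoPointPlus (d' + 1) (criticalBeta (d' + 1))

/-- `⟨σ₀σ_x⟩_{β_c} ≥ 0` (GKS I). [cite: FriedliVelenik2017, Thm. 3.20, eq. (3.21)] -/
theorem critS_nonneg (x : Site (d' + 1)) : 0 ≤ S x :=
  twoPointPlus_nonneg_of_gks (criticalBeta_nonneg (d' + 1)) x

/-- `⟨σ₀σ_x⟩_{β_c} ≤ 1`. [cite: FriedliVelenik2017, §3.6.1] -/
theorem critS_le_one (x : Site (d' + 1)) : S x ≤ 1 :=
  twoPointPlus_le_one_of_nonneg (criticalBeta_nonneg (d' + 1)) x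

/-- `⟨σ₀σ_{je_i}⟩_{β_c} > 0` on the axis (`d' + 1 ≥ 2`), from the lower bound
`⟨σ₀σ_x⟩_{β_c} ≥ c‖x‖^{1-d}` (Duminil-Copin 2019, Thm. 4.8; the tree's `criticalTwoPoint_lower`). [cite: DuminilCopin2019, Thm. 4.8, §4.4] -/
theorem critS_single_pos (hd : 2 ≤ d' + 1) (i : Fin (d' + 1)) (j : ℕ) :
    0 < S (Pi.single i (j : ℤ)) := by
  rcases Nat.eq_zero_or_pos j with rfl | hj
  · simp [twoPointPlus_origin]
  · obtain ⟨c, hc, hlow⟩ := criticalTwoPoint_lower (d := d' + 1) hd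
    have hx : (Pi.single i (j : ℤ) : Site (d' + 1)) ≠ 0 := by
      intro h
      have := congrFun h i
      simp at this
      omega
    have h : c * (‖(Pi.single i (j : ℤ) : Site (d' + 1))‖ : ℝ) ^ (-((((d' + 1 : ℕ)) : ℝ) - 1)) ≤
        S (Pi.single i (j : ℤ)) := hlow _ hx
    have hnorm : 0 < ‖(Pi.single i (j : ℤ) : Site (d' + 1))‖ := norm_pos_iff.2 hx
    exact lt_of_lt_of_le (mul_pos hc (Real.rpow_pos_of_pos hnorm _)) h

/-- MMS along an axis, iterated: `⟨σ₀σ_{z + m e_i}⟩_{β_c} ≤ ⟨σ₀σ_z⟩_{β_c}` for `z_i ≥ 0`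
(Messager–Miracle-Solé 1977; Duminil-Copin–Panis 2025, §1, MMS footnote (i)). [cite: DuminilCopinPanis2025LowerBounds, §1, footnote on the MMS inequalities, item (i)] -/
theorem critS_add_single_le (z : Site (d' + 1)) (i : Fin (d' + 1)) (hz : 0 ≤ z i) (m : ℕ) :
    S (z + Pi.single i (m : ℤ)) ≤ S z :=
  twoPointPlus_add_single_le messager_miracleSole_holds (criticalBeta_nonneg (d' + 1)) z i hz m

/-- `k ↦ ⟨σ₀σ_{ke_i}⟩_{β_c}` is nonincreasing on `ℕ` (Duminil-Copin–Panis 2025, §1, MMS footnote (i):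
"the sequence `(⟨τ₀τ_{ke₁}⟩_β)_{k≥0}` is decreasing"). [cite: DuminilCopinPanis2025LowerBounds, §1, footnote on the MMS inequalities, item (i)] -/
theorem critS_single_anti (i : Fin (d' + 1)) {m m' : ℕ} (h : m ≤ m') :
    S (Pi.single i (m' : ℤ)) ≤ S (Pi.single i (m : ℤ)) := by
  have key := critS_add_single_le (Pi.single i (m : ℤ)) i (by simp) (m' - m)
  rwa [← Pi.single_add, ← Nat.cast_add, Nat.add_sub_cancel' h] at key

/-- MMS, sup-norm form: `⟨σ₀σ_y⟩_{β_c} ≤ ⟨σ₀σ_{‖y‖_∞ e_i}⟩_{β_c}` (Duminil-Copin–Panis 2025,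
§1, MMS footnote (ii): `⟨τ₀τ_x⟩ ≤ ⟨τ₀τ_{(|x|,0_⊥)}⟩`). [cite: DuminilCopinPanis2025LowerBounds, §1, footnote on the MMS inequalities, item (ii)] -/
theorem critS_le_single_supNorm (y : Site (d' + 1)) (i : Fin (d' + 1)) :
    S y ≤ S (Pi.single i (Site.supNorm y : ℤ)) := by
  have hd1 : 1 ≤ d' + 1 := by omega
  have h := twoPointPlus_le_axis_of_mem_sphere (d := d' + 1) messager_miracleSole_holds
    twoPointPlus_reflection_invariant_holds twoPointPlus_perm_invariant_holds (criticalBeta_nonneg (d' + 1))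
    hd1 (show y ∈ sphere (d' + 1) (Site.supNorm y) from mem_sphere.2 rfl)
  rwa [twoPointPlus_single_eq_single twoPointPlus_perm_invariant_holds (criticalBeta_nonneg (d' + 1))
    ⟨0, hd1⟩ i] at h

/-- `⟨σ₀σ_y⟩_{β_c} ≤ ⟨σ₀σ_{n e_i}⟩_{β_c}` whenever `n ≤ ‖y‖_∞` (MMS footnote (i)+(ii) of the
source, §1). [cite: DuminilCopinPanis2025LowerBounds, §1, footnote on the MMS inequalities] -/
theorem critS_le_single_of_le_supNorm (y : Site (d' + 1)) (i : Fin (d' + 1)) {n : ℕ}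
    (hn : n ≤ Site.supNorm y) : S y ≤ S (Pi.single i (n : ℤ)) :=
  (critS_le_single_supNorm y i).trans (critS_single_anti i hn)

/-- **The gradient estimate of Duminil-Copin–Panis 2025 (proof of Thm. 1.3) at `β_c`**, in the form used in
the proof of Theorem 1.3: for `x_⊥` in the hyperplane `{x_i = 0}`, `n ≥ 1` and `a > 2n`,
`⟨σ₀σ_{x_⊥ + a e_i}⟩_{β_c} - ⟨σ₀σ_{x_⊥ + (a+l) e_i}⟩_{β_c} ≤ l · 2⟨σ₀σ_{ne_i}⟩_{β_c}/n`.
Proof as in its footnote / ADC 2021 Prop. 5.9, with log-convexity for the spectral measure: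
`w_k = ⟨σ₀σ_{ke_i}⟩ + ⟨σ₀σ_{x_⊥+ke_i}⟩` is positive, nonincreasing (MMS) and log-convex
(`twoPointPlus_axisPair_sq_le`, `m*(β_c) = 0` for `d ≥ 3`), so each decrement of
`k ↦ ⟨σ₀σ_{x_⊥+ke_i}⟩` beyond `2n` is at most `w_n/n ≤ 2⟨σ₀σ_{ne_i}⟩/n`; telescope. [cite: DuminilCopinPanis2025LowerBounds, §1.1, proof of Theorem 1.3, the gradient estimate and its footnote (p. 5)] -/
theorem gradient_estimate (hd : 3 ≤ d' + 1) (i : Fin (d' + 1)) (xp : Site (d' + 1))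
    (hxp : xp i = 0) {n a : ℕ} (hn : 1 ≤ n) (ha : 2 * n < a) (l : ℕ) :
    S (xp + Pi.single i (a : ℤ)) - S (xp + Pi.single i ((a + l : ℕ) : ℤ)) ≤
      l * (2 * S (Pi.single i (n : ℤ)) / n) := by
  have hβ : 0 ≤ criticalBeta (d' + 1) := criticalBeta_nonneg (d' + 1)
  have hm : spontaneousMagnetization (d' + 1) (criticalBeta (d' + 1)) = 0 :=
    spontaneousMagnetization_criticalBeta_eq_zero_holds hd
  set u : ℕ → ℝ := fun j => S (Pi.single i (j : ℤ)) with hu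
  set v : ℕ → ℝ := fun j => S (xp + Pi.single i (j : ℤ)) with hv
  set w : ℕ → ℝ := fun j => u j + v j with hw
  have hu_pos : ∀ j, 0 < u j := fun j => critS_single_pos (by omega) i j
  have hw_pos : ∀ j, 0 < w j := fun j => add_pos_of_pos_of_nonneg (hu_pos j) (critS_nonneg _)
  have hu_mono : ∀ j, u (j + 1) ≤ u j := fun j => by
    have h1 := critS_add_single_le (Pi.single i (j : ℤ)) i (by simp) 1
    rwa [← Pi.single_add, ← Nat.cast_add] at h1
  have hv_mono : ∀ j, v (j + 1) ≤ v j := fun j => by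
    have h1 := critS_add_single_le (xp + Pi.single i (j : ℤ)) i (by simp [hxp]) 1
    rwa [add_assoc, ← Pi.single_add, ← Nat.cast_add] at h1
  have hw_mono : ∀ j, w (j + 1) ≤ w j := fun j => add_le_add (hu_mono j) (hv_mono j)
  have hw_conv : ∀ j, w (j + 1) ^ 2 ≤ w j * w (j + 2) := fun j => by
    have key := twoPointPlus_axisPair_sq_le hβ hm i xp hxp (n := j + 1) (by omega)
    simp only [Nat.add_sub_cancel] at key
    exact key
  -- `v_n ≤ u_n` (MMS, sup-norm form), hence `w_n ≤ 2 u_n`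
  have hvu : v n ≤ u n := by
    have hsup : n ≤ Site.supNorm (xp + Pi.single i (n : ℤ)) := by
      have h1 := Site.natAbs_le_supNorm (xp + Pi.single i (n : ℤ)) i
      simp [hxp] at h1
      exact h1
    exact critS_le_single_of_le_supNorm _ i hsup
  have hnpos : (0 : ℝ) < n := by exact_mod_cast hn
  -- each decrement beyond `2n` is at most `2 u_n / n`
  have hdec : ∀ j, a ≤ j → j < a + l → v j - v (j + 1) ≤ 2 * u n / n := by
    intro j hj _
    have h1 : v j - v (j + 1) ≤ w j - w (j + 1) := by
      have := hu_mono j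
      simp only [hw]
      linarith
    have h2 : w j - w (j + 1) ≤ w n / ((j : ℝ) - n + 1) :=
      sub_succ_le_of_logConvex w hw_pos hw_mono hw_conv (by omega)
    have h3 : w n / ((j : ℝ) - n + 1) ≤ w n / n := by
      refine div_le_div_of_nonneg_left (hw_pos n).le hnpos ?_
      have : (2 * n + 1 : ℝ) ≤ j := by exact_mod_cast (show 2 * n + 1 ≤ j by omega)
      linarith
    have h4 : w n / n ≤ 2 * u n / n := by
      refine div_le_div_of_nonneg_right ?_ hnpos.le
      simp only [hw]
      linarith
    linarith
  have key := sub_le_mul_of_sub_succ_le v (2 * u n / n) a l hdec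
  simpa [hv, hu] using key

/-- At `β_c`, `d ≥ 3`: `⟨τ_y τ_{𝓡_N(y)}⟩ = ⟨σ₀σ_{2(N - y_i) e_i}⟩_{β_c}` (translation invariance,
and `μ^f_{β_c} = μ⁺_{β_c}` on pairs, ADS 2015; `𝓡_N(y) - y = 2(N - y_i)e_i`). [cite: DuminilCopinPanis2025LowerBounds, §1.1 (definition of 𝓡_n before Theorem 1.2)] -/
theorem freeExpect_spinPair_dcpReflect (hd : 3 ≤ d' + 1) (i : Fin (d' + 1)) (N : ℤ)
    (y : Site (d' + 1)) :
    freeExpect (d' + 1) (criticalBeta (d' + 1)) 0 (spinPair y (dcpReflect i N y)) =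
      S (Pi.single i (2 * (N - y i))) := by
  have hβ : 0 ≤ criticalBeta (d' + 1) := criticalBeta_nonneg (d' + 1)
  have h1 : freeExpect (d' + 1) (criticalBeta (d' + 1)) 0 (spinPair y (dcpReflect i N y)) =
      freePair (d' + 1) (criticalBeta (d' + 1)) y (dcpReflect i N y) := rfl
  rw [h1, ← plusPair_eq_freePair_of_lroTildeSq_holds hβ (lroTildeSq_criticalBeta_eq_zero_holds hd),
    plusPair_eq_twoPointPlus_sub hβ]
  congr 1
  funext j
  by_cases hj : j = i
  · rw [hj]
    simp only [dcpReflect, Pi.sub_apply, Function.update_self, Pi.single_eq_same]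
    ring
  · simp only [dcpReflect, Pi.sub_apply, Function.update_of_ne hj, Pi.single_eq_of_ne hj, sub_self]

/-- At `β_c`, `d ≥ 3`: `⟨σ₀σ_x⟩^f_{β_c} = ⟨σ₀σ_x⟩⁺_{β_c}` (ADS 2015, via the tree's
`twoPointPlus_criticalBeta_eq_twoPointFree_holds`). [cite: AizenmanDuminilCopinSidoraviciusCMP2015, Thm. 1.2 with §3.3] -/
theorem twoPointFree_criticalBeta_eq (hd : 3 ≤ d' + 1) (x : Site (d' + 1)) :
    twoPointFree (d' + 1) (criticalBeta (d' + 1)) x = S x :=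
  (twoPointPlus_criticalBeta_eq_twoPointFree_holds hd x).symm

/-- Neighbours in `ℤ^d` differ by at most one in every coordinate. [folklore] -/
theorem coord_le_of_adj {x y : Site (d' + 1)} (h : (zdGraph (d' + 1)).Adj x y) (i : Fin (d' + 1)) :
    y i ≤ x i + 1 ∧ x i ≤ y i + 1 := by
  obtain ⟨j, h | h⟩ := (zdGraph_adj_iff x y).1 h
  · have hyi : y i = x i + (Pi.single j (1 : ℤ) : Site (d' + 1)) i := by rw [h]; rfl
    by_cases hij : i = j
    · subst hij
      simp at hyi
      omega
    · simp [Pi.single_eq_of_ne hij] at hyi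
      omega
  · have hxi : x i = y i + (Pi.single j (1 : ℤ) : Site (d' + 1)) i := by rw [h]; rfl
    by_cases hij : i = j
    · subst hij
      simp at hxi
      omega
    · simp [Pi.single_eq_of_ne hij] at hxi
      omega

/-- **Terms with `x_i ≤ N/2`** (first display of the proof of Thm. 1.3, at scale `N = 4n`): for
neighbours `x ∼ y` in `Λ_{4n}` with `x_i ≤ 2n`,
`(⟨σ₀σ_x⟩ - ⟨σ₀σ_{𝓡x}⟩)⟨σ_yσ_{𝓡y}⟩ ≤ ⟨σ₀σ_x⟩⟨σ₀σ_{ne_i}⟩` (drop `⟨σ₀σ_{𝓡x}⟩ ≥ 0`; by MMS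
`⟨σ_yσ_{𝓡y}⟩ = ⟨σ₀σ_{2(4n-y_i)e_i}⟩ ≤ ⟨σ₀σ_{ne_i}⟩` as `2(4n - y_i) ≥ n`). [cite: DuminilCopinPanis2025LowerBounds, proof of Theorem 1.3, first display] -/
theorem term_le_of_le (i : Fin (d' + 1)) {n : ℕ} {x y : Site (d' + 1)}
    (hy : y ∈ box (d' + 1) (4 * n)) (hadj : (zdGraph (d' + 1)).Adj x y) (hxi : x i ≤ 2 * n) :
    (S x - S (dcpReflect i ((4 * n : ℕ) : ℤ) x)) *
        S (Pi.single i (2 * (((4 * n : ℕ) : ℤ) - y i))) ≤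
      S x * S (Pi.single i (n : ℤ)) := by
  have hyi := (coord_le_of_adj hadj i).1
  have hyN : y i ≤ ((4 * n : ℕ) : ℤ) := (mem_box.1 hy i).2
  obtain ⟨M, hM⟩ := Int.eq_ofNat_of_zero_le
    (show (0 : ℤ) ≤ 2 * (((4 * n : ℕ) : ℤ) - y i) by omega)
  have hnM : n ≤ M := by
    have : (n : ℤ) ≤ 2 * (((4 * n : ℕ) : ℤ) - y i) := by push_cast at hxi hyN ⊢; omega
    rw [hM] at this
    exact_mod_cast this
  rw [hM]
  have hpair : S (Pi.single i (M : ℤ)) ≤ S (Pi.single i (n : ℤ)) := critS_single_anti i hnM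
  have hpair0 : 0 ≤ S (Pi.single i (M : ℤ)) := critS_nonneg _
  have hSx : 0 ≤ S x := critS_nonneg _
  have hR : 0 ≤ S (dcpReflect i ((4 * n : ℕ) : ℤ) x) := critS_nonneg _
  calc (S x - S (dcpReflect i ((4 * n : ℕ) : ℤ) x)) * S (Pi.single i (M : ℤ))
      ≤ S x * S (Pi.single i (M : ℤ)) := by
        refine mul_le_mul_of_nonneg_right ?_ hpair0
        linarith
    _ ≤ S x * S (Pi.single i (n : ℤ)) := mul_le_mul_of_nonneg_left hpair hSx

/-- **Terms with `x_i > N/2`** (second display of the proof of Thm. 1.3, at scale `N = 4n`, with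
`k = 4n - x_i`): for neighbours `x ∼ y` in `Λ_{4n}` with `x_i > 2n`,
`(⟨σ₀σ_x⟩ - ⟨σ₀σ_{𝓡x}⟩)⟨σ_yσ_{𝓡y}⟩ ≤ (4k/n)⟨σ₀σ_{ne_i}⟩ · ⟨σ₀σ_{(k-1)e_i}⟩`, by the gradient
estimate (`|x - 𝓡x| = 2k`) and MMS (`⟨σ_yσ_{𝓡y}⟩ = ⟨σ₀σ_{2(4n-y_i)e_i}⟩ ≤ ⟨σ₀σ_{(k-1)e_i}⟩` as
`2(4n - y_i) ≥ k - 1`; the term vanishes for `k = 0`). [cite: DuminilCopinPanis2025LowerBounds, proof of Theorem 1.3, the gradient estimate and the display following it (p. 5)] -/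
theorem term_le_of_lt (hd : 3 ≤ d' + 1) (i : Fin (d' + 1)) {n : ℕ} (hn : 1 ≤ n)
    {x y : Site (d' + 1)} (hx : x ∈ box (d' + 1) (4 * n)) (hy : y ∈ box (d' + 1) (4 * n))
    (hadj : (zdGraph (d' + 1)).Adj x y) (hxi : 2 * (n : ℤ) < x i) :
    (S x - S (dcpReflect i ((4 * n : ℕ) : ℤ) x)) *
        S (Pi.single i (2 * (((4 * n : ℕ) : ℤ) - y i))) ≤
      4 * ((((4 * n : ℕ) : ℤ) - x i : ℤ) : ℝ) / n * S (Pi.single i (n : ℤ)) *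
        S (Pi.single i (((4 * n : ℕ) : ℤ) - x i - 1)) := by
  have hxN : x i ≤ ((4 * n : ℕ) : ℤ) := (mem_box.1 hx i).2
  have hyN : y i ≤ ((4 * n : ℕ) : ℤ) := (mem_box.1 hy i).2
  have hyi := (coord_le_of_adj hadj i).1
  obtain ⟨k, hk⟩ := Int.eq_ofNat_of_zero_le (sub_nonneg.2 hxN)
  obtain ⟨a, ha⟩ := Int.eq_ofNat_of_zero_le (show (0 : ℤ) ≤ x i by omega)
  -- `x = x_⊥ + a e_i`, `𝓡x = x_⊥ + (a + 2k) e_i`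
  set xp : Site (d' + 1) := Function.update x i 0 with hxp
  have hxp0 : xp i = 0 := by simp [hxp]
  have hx_eq : xp + Pi.single i (a : ℤ) = x := by
    funext j
    by_cases hj : j = i
    · rw [hj]
      simp [hxp, ha]
    · simp [hxp, hj]
  have hRx_eq : xp + Pi.single i ((a + 2 * k : ℕ) : ℤ) = dcpReflect i ((4 * n : ℕ) : ℤ) x := by
    funext j
    by_cases hj : j = i
    · rw [hj]
      simp [hxp, dcpReflect]
      omega
    · simp [hxp, hj, dcpReflect]
  have ha' : 2 * n < a := by
    rw [ha] at hxi
    exact_mod_cast hxi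
  have hgrad := gradient_estimate hd i xp hxp0 hn ha' (2 * k)
  rw [hx_eq, hRx_eq] at hgrad
  have hnpos : (0 : ℝ) < n := by exact_mod_cast hn
  have hdiff : S x - S (dcpReflect i ((4 * n : ℕ) : ℤ) x) ≤
      4 * (k : ℝ) / n * S (Pi.single i (n : ℤ)) := by
    refine hgrad.trans (le_of_eq ?_)
    push_cast
    ring
  have hpair0 : 0 ≤ S (Pi.single i (2 * (((4 * n : ℕ) : ℤ) - y i))) := critS_nonneg _
  have hcoef : 0 ≤ 4 * (k : ℝ) / n * S (Pi.single i (n : ℤ)) :=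
    mul_nonneg (by positivity) (critS_nonneg _)
  rw [hk, Int.cast_natCast]
  calc (S x - S (dcpReflect i ((4 * n : ℕ) : ℤ) x)) *
        S (Pi.single i (2 * (((4 * n : ℕ) : ℤ) - y i)))
      ≤ 4 * (k : ℝ) / n * S (Pi.single i (n : ℤ)) *
          S (Pi.single i (2 * (((4 * n : ℕ) : ℤ) - y i))) :=
        mul_le_mul_of_nonneg_right hdiff hpair0
    _ ≤ 4 * (k : ℝ) / n * S (Pi.single i (n : ℤ)) * S (Pi.single i ((k : ℤ) - 1)) := by
        rcases Nat.eq_zero_or_pos k with rfl | hkpos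
        · -- `k = 0`: `x` lies on the hyperplane and the term vanishes
          simp
        · refine mul_le_mul_of_nonneg_left ?_ hcoef
          obtain ⟨M, hM⟩ := Int.eq_ofNat_of_zero_le
            (show (0 : ℤ) ≤ 2 * (((4 * n : ℕ) : ℤ) - y i) by omega)
          have hkM : k - 1 ≤ M := by
            have h1 : (k : ℤ) - 1 ≤ 2 * (((4 * n : ℕ) : ℤ) - y i) := by omega
            rw [hM] at h1
            omega
          rw [hM, show (k : ℤ) - 1 = ((k - 1 : ℕ) : ℤ) by omega]
          exact critS_single_anti i hkM

/-! ### Part 3. Summing the majorants over `Λ_{4n}` -/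

/-- The termwise majorant of Part 2 is nonnegative. [cite: DuminilCopinPanis2025LowerBounds, proof of Theorem 1.3] -/
theorem majorant_nonneg (i : Fin (d' + 1)) {n : ℕ} {x : Site (d' + 1)}
    (hx : x ∈ box (d' + 1) (4 * n)) :
    0 ≤ (if x i ≤ 2 * n then S x * S (Pi.single i (n : ℤ))
         else 4 * ((((4 * n : ℕ) : ℤ) - x i : ℤ) : ℝ) / n * S (Pi.single i (n : ℤ)) *
           S (Pi.single i (((4 * n : ℕ) : ℤ) - x i - 1))) := by
  split_ifs with h
  · exact mul_nonneg (critS_nonneg _) (critS_nonneg _)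
  · have hxN : x i ≤ ((4 * n : ℕ) : ℤ) := (mem_box.1 hx i).2
    have h0 : (0 : ℝ) ≤ ((((4 * n : ℕ) : ℤ) - x i : ℤ) : ℝ) := by exact_mod_cast sub_nonneg.2 hxN
    exact mul_nonneg (mul_nonneg (by positivity) (critS_nonneg _)) (critS_nonneg _)

/-- **One row of the sum of Theorem 1.2** (over the `≤ 2d` neighbours `y ∈ Λ_{4n}` of a fixed
`x ∈ Λ_{4n}`) is at most `2d` times the termwise majorant (`term_le_of_le` / `term_le_of_lt`). [cite: DuminilCopinPanis2025LowerBounds, proof of Theorem 1.3] -/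
theorem row_sum_le (hd : 3 ≤ d' + 1) (i : Fin (d' + 1)) {n : ℕ} (hn : 1 ≤ n) {x : Site (d' + 1)}
    (hx : x ∈ box (d' + 1) (4 * n)) :
    (∑ y ∈ box (d' + 1) (4 * n),
        if (zdGraph (d' + 1)).Adj x y then
          (S x - S (dcpReflect i ((4 * n : ℕ) : ℤ) x)) *
            S (Pi.single i (2 * (((4 * n : ℕ) : ℤ) - y i)))
        else 0) ≤
      (2 * ((d' : ℝ) + 1)) *
        (if x i ≤ 2 * n then S x * S (Pi.single i (n : ℤ))
         else 4 * ((((4 * n : ℕ) : ℤ) - x i : ℤ) : ℝ) / n * S (Pi.single i (n : ℤ)) *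
           S (Pi.single i (((4 * n : ℕ) : ℤ) - x i - 1))) := by
  have hG0 := majorant_nonneg i hx
  -- name the majorant
  generalize hG : (if x i ≤ 2 * n then S x * S (Pi.single i (n : ℤ))
         else 4 * ((((4 * n : ℕ) : ℤ) - x i : ℤ) : ℝ) / n * S (Pi.single i (n : ℤ)) *
           S (Pi.single i (((4 * n : ℕ) : ℤ) - x i - 1))) = G at hG0 ⊢
  have hterm : ∀ y ∈ box (d' + 1) (4 * n), (zdGraph (d' + 1)).Adj x y →
      (S x - S (dcpReflect i ((4 * n : ℕ) : ℤ) x)) *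
          S (Pi.single i (2 * (((4 * n : ℕ) : ℤ) - y i))) ≤ G := by
    intro y hy hadj
    rw [← hG]
    split_ifs with hxi
    · exact term_le_of_le i hy hadj hxi
    · exact term_le_of_lt hd i hn hx hy hadj (not_le.1 hxi)
  calc (∑ y ∈ box (d' + 1) (4 * n),
          if (zdGraph (d' + 1)).Adj x y then
            (S x - S (dcpReflect i ((4 * n : ℕ) : ℤ) x)) *
              S (Pi.single i (2 * (((4 * n : ℕ) : ℤ) - y i)))
          else 0)
      ≤ ∑ y ∈ box (d' + 1) (4 * n), if (zdGraph (d' + 1)).Adj x y then G else 0 := by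
        refine Finset.sum_le_sum fun y hy => ?_
        split_ifs with hadj
        · exact hterm y hy hadj
        · exact le_rfl
    _ = ∑ y ∈ (box (d' + 1) (4 * n)).filter (fun y => (zdGraph (d' + 1)).Adj x y), G :=
        (Finset.sum_filter _ _).symm
    _ = (#((box (d' + 1) (4 * n)).filter (fun y => (zdGraph (d' + 1)).Adj x y)) : ℝ) * G := by
        rw [Finset.sum_const, nsmul_eq_mul]
    _ ≤ (2 * ((d' : ℝ) + 1)) * G := by
        refine mul_le_mul_of_nonneg_right ?_ hG0
        have hsub : (box (d' + 1) (4 * n)).filter (fun y => (zdGraph (d' + 1)).Adj x y) ⊆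
            (zdGraph (d' + 1)).neighborFinset x := by
          intro y hy
          rw [SimpleGraph.mem_neighborFinset]
          exact (Finset.mem_filter.1 hy).2
        have h := (Finset.card_le_card hsub).trans (card_neighborFinset_zdGraph_holds x).le
        exact_mod_cast h

/-- A hyperplane section `{x ∈ Λ_N : x_i = a}` of the box has `(2N+1)^{d-1}` sites. [folklore] -/
theorem card_filter_box_apply_eq (i : Fin (d' + 1)) (N : ℕ) {a : ℤ}
    (ha : a ∈ Finset.Icc (-(N : ℤ)) N) :
    #{x ∈ box (d' + 1) N | x i = a} = (2 * N + 1) ^ d' := by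
  unfold box
  rw [Fintype.card_filter_piFinset_const_eq_of_mem _ i ha, Int.card_Icc, Fintype.card_fin,
    Nat.add_sub_cancel]
  congr 1
  omega

/-- **The boundary sum** `∑_{j<2n} j ⟨σ₀σ_{(j-1)e_i}⟩ ≤ 1 + 2 ∑_{1≤k≤2n} k ⟨σ₀σ_{ke_i}⟩` (the `j = 1`
term is `⟨σ₀σ₀⟩ = 1`; for `j ≥ 2`, `j ≤ 2(j-1)`). [cite: DuminilCopinPanis2025LowerBounds, proof of Theorem 1.3, display following the gradient estimate (p. 5)] -/
theorem boundary_sum_le (i : Fin (d' + 1)) {n : ℕ} (hn : 1 ≤ n) :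
    (∑ j ∈ Finset.range (2 * n), (j : ℝ) * S (Pi.single i ((j : ℤ) - 1))) ≤
      1 + 2 * ∑ k ∈ Finset.Icc 1 (2 * n), (k : ℝ) * S (Pi.single i (k : ℤ)) := by
  obtain ⟨m, hm, hmn⟩ : ∃ m, 2 * n = m + 1 ∧ m ≤ 2 * n := ⟨2 * n - 1, by omega, by omega⟩
  have hL : ∑ j ∈ Finset.range (2 * n), (j : ℝ) * S (Pi.single i ((j : ℤ) - 1)) =
      ∑ j ∈ Finset.range m, ((j : ℝ) + 1) * S (Pi.single i (j : ℤ)) := by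
    rw [hm, Finset.sum_range_succ']
    simp only [Nat.cast_zero, zero_mul, add_zero, Nat.cast_add, Nat.cast_one, add_sub_cancel_right]
  rw [hL, Finset.range_eq_Ico, Finset.sum_eq_sum_Ico_succ_bot (by omega : 0 < m)]
  have h0 : ((((0 : ℕ) : ℝ) + 1) * S (Pi.single i ((0 : ℕ) : ℤ))) = 1 := by
    simp [twoPointPlus_origin]
  rw [h0]
  have hIco : ∑ j ∈ Finset.Ico 1 m, ((j : ℝ) + 1) * S (Pi.single i (j : ℤ)) ≤
      ∑ j ∈ Finset.Icc 1 (2 * n), 2 * ((j : ℝ) * S (Pi.single i (j : ℤ))) := by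
    calc ∑ j ∈ Finset.Ico 1 m, ((j : ℝ) + 1) * S (Pi.single i (j : ℤ))
        ≤ ∑ j ∈ Finset.Ico 1 m, 2 * ((j : ℝ) * S (Pi.single i (j : ℤ))) := by
          refine Finset.sum_le_sum fun j hj => ?_
          have hj1 : (1 : ℝ) ≤ j := by exact_mod_cast (Finset.mem_Ico.1 hj).1
          have hS := critS_nonneg (d' := d') (Pi.single i (j : ℤ))
          nlinarith
      _ ≤ ∑ j ∈ Finset.Icc 1 (2 * n), 2 * ((j : ℝ) * S (Pi.single i (j : ℤ))) := by
          refine Finset.sum_le_sum_of_subset_of_nonneg ?_ fun j _ _ =>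
            mul_nonneg (by norm_num) (mul_nonneg (Nat.cast_nonneg j) (critS_nonneg _))
          intro j hj
          rw [Finset.mem_Ico] at hj
          rw [Finset.mem_Icc]
          omega
  rw [← Finset.mul_sum] at hIco
  linarith

/-- **Sum of the majorants over `Λ_{4n}`**: the part `x_i ≤ 2n` gives `⟨σ₀σ_{ne_i}⟩ χ_{4n}` and the
part `x_i > 2n`, summed over the `(8n+1)^{d-1}` sites of each hyperplane `{x_i = 4n - k}`,
`0 ≤ k < 2n`, gives `(4⟨σ₀σ_{ne_i}⟩/n)(8n+1)^{d-1}(1 + 2∑_{k≤2n} k⟨σ₀σ_{ke_i}⟩)` (the first display and the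
display following the gradient estimate of the proof of Thm. 1.3, at scale `4n`). [cite: DuminilCopinPanis2025LowerBounds, proof of Theorem 1.3, first display and the display following the gradient estimate (p. 5)] -/
theorem sum_majorant_le (i : Fin (d' + 1)) {n : ℕ} (hn : 1 ≤ n) :
    (∑ x ∈ box (d' + 1) (4 * n),
        (if x i ≤ 2 * n then S x * S (Pi.single i (n : ℤ))
         else 4 * ((((4 * n : ℕ) : ℤ) - x i : ℤ) : ℝ) / n * S (Pi.single i (n : ℤ)) *
           S (Pi.single i (((4 * n : ℕ) : ℤ) - x i - 1)))) ≤
      S (Pi.single i (n : ℤ)) * (∑ x ∈ box (d' + 1) (4 * n), S x) +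
        4 * S (Pi.single i (n : ℤ)) / n * ((2 * (4 * n : ℕ) + 1 : ℕ) : ℝ) ^ d' *
          (1 + 2 * ∑ k ∈ Finset.Icc 1 (2 * n), (k : ℝ) * S (Pi.single i (k : ℤ))) := by
  rw [Finset.sum_ite]
  refine add_le_add ?_ ?_
  · -- the part `x_i ≤ 2n`
    calc ∑ x ∈ (box (d' + 1) (4 * n)).filter (fun x : Site (d' + 1) => x i ≤ 2 * (n : ℤ)),
          S x * S (Pi.single i (n : ℤ))
        ≤ ∑ x ∈ box (d' + 1) (4 * n), S x * S (Pi.single i (n : ℤ)) :=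
          Finset.sum_le_sum_of_subset_of_nonneg (Finset.filter_subset _ _)
            fun x _ _ => mul_nonneg (critS_nonneg _) (critS_nonneg _)
      _ = S (Pi.single i (n : ℤ)) * ∑ x ∈ box (d' + 1) (4 * n), S x := by
          rw [Finset.mul_sum]
          exact Finset.sum_congr rfl fun x _ => mul_comm _ _
  · -- the part `x_i > 2n`: slice along the hyperplanes `x_i = a`
    set N : ℕ := 4 * n with hN
    set F : ℤ → ℝ := fun a => (((N : ℤ) - a : ℤ) : ℝ) * S (Pi.single i ((N : ℤ) - a - 1)) with hF
    have hF0 : ∀ a : ℤ, a ≤ N → 0 ≤ F a := fun a ha =>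
      mul_nonneg (by exact_mod_cast sub_nonneg.2 ha) (critS_nonneg _)
    have hterm : ∀ x : Site (d' + 1),
        4 * ((((N : ℕ) : ℤ) - x i : ℤ) : ℝ) / n * S (Pi.single i (n : ℤ)) *
            S (Pi.single i ((N : ℤ) - x i - 1)) =
          4 * S (Pi.single i (n : ℤ)) / n * F (x i) := by
      intro x
      simp only [hF]
      ring
    rw [Finset.sum_congr rfl fun x _ => hterm x, ← Finset.mul_sum, mul_assoc]
    have hcoef : 0 ≤ 4 * S (Pi.single i (n : ℤ)) / n :=
      div_nonneg (mul_nonneg (by norm_num) (critS_nonneg _)) (Nat.cast_nonneg n)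
    refine mul_le_mul_of_nonneg_left ?_ hcoef
    -- fibres of `x ↦ x_i`
    set s := (box (d' + 1) N).filter (fun x : Site (d' + 1) => ¬ x i ≤ 2 * (n : ℤ)) with hs
    set T := (Finset.Icc (-(N : ℤ)) N).filter (fun a : ℤ => ¬ a ≤ 2 * (n : ℤ)) with hT
    have hmaps : ∀ x ∈ s, x i ∈ T := by
      intro x hx
      rw [hs, Finset.mem_filter] at hx
      rw [hT, Finset.mem_filter, Finset.mem_Icc]
      exact ⟨mem_box.1 hx.1 i, hx.2⟩
    rw [← Finset.sum_fiberwise_of_maps_to hmaps]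
    have hTN : ∀ a ∈ T, a ≤ N := fun a ha =>
      (Finset.mem_Icc.1 (Finset.mem_filter.1 ha).1).2
    calc ∑ a ∈ T, ∑ x ∈ s with x i = a, F (x i)
        ≤ ∑ a ∈ T, ((2 * N + 1 : ℕ) : ℝ) ^ d' * F a := by
          refine Finset.sum_le_sum fun a ha => ?_
          have hfa : ∑ x ∈ s with x i = a, F (x i) = ∑ x ∈ s with x i = a, F a :=
            Finset.sum_congr rfl fun x hx => by rw [(Finset.mem_filter.1 hx).2]
          rw [hfa, Finset.sum_const, nsmul_eq_mul]
          refine mul_le_mul_of_nonneg_right ?_ (hF0 a (hTN a ha))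
          have hsub : s.filter (fun x => x i = a) ⊆ (box (d' + 1) N).filter (fun x => x i = a) :=
            Finset.filter_subset_filter _ (Finset.filter_subset _ _)
          have hcard := (Finset.card_le_card hsub).trans
            (card_filter_box_apply_eq i N (Finset.mem_filter.1 ha).1).le
          exact_mod_cast hcard
      _ = ((2 * N + 1 : ℕ) : ℝ) ^ d' * ∑ a ∈ T, F a := by rw [Finset.mul_sum]
      _ ≤ ((2 * N + 1 : ℕ) : ℝ) ^ d' *
            (1 + 2 * ∑ k ∈ Finset.Icc 1 (2 * n), (k : ℝ) * S (Pi.single i (k : ℤ))) := by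
          refine mul_le_mul_of_nonneg_left ?_ (by positivity)
          -- reindex by `j = N - a ∈ [0, 2n)`
          have hinj : Set.InjOn (fun a : ℤ => ((N : ℤ) - a).toNat) T := by
            intro a ha b hb hab
            have ha' := hTN a ha
            have hb' := hTN b hb
            have h1 : (((N : ℤ) - a).toNat : ℤ) = ((N : ℤ) - b).toNat := by exact_mod_cast hab
            rw [Int.toNat_of_nonneg (sub_nonneg.2 ha'), Int.toNat_of_nonneg (sub_nonneg.2 hb')] at h1
            linarith
          have hre : ∑ a ∈ T, F a =
              ∑ j ∈ T.image (fun a : ℤ => ((N : ℤ) - a).toNat), (j : ℝ) * S (Pi.single i ((j : ℤ) - 1)) := by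
            rw [Finset.sum_image hinj]
            refine Finset.sum_congr rfl fun a ha => ?_
            have h1 : (((N : ℤ) - a).toNat : ℤ) = (N : ℤ) - a :=
              Int.toNat_of_nonneg (sub_nonneg.2 (hTN a ha))
            simp only [hF]
            rw [show ((((N : ℤ) - a).toNat : ℕ) : ℝ) = (((N : ℤ) - a : ℤ) : ℝ) by exact_mod_cast h1, h1]
          rw [hre]
          have himage : T.image (fun a : ℤ => ((N : ℤ) - a).toNat) ⊆ Finset.range (2 * n) := by
            intro j hj
            obtain ⟨a, ha, rfl⟩ := Finset.mem_image.1 hj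
            have h1 := Finset.mem_filter.1 ha
            rw [Finset.mem_range]
            have h2 : (N : ℤ) - a < 2 * n := by push_cast [hN] at h1 ⊢; omega
            omega
          calc ∑ j ∈ T.image (fun a : ℤ => ((N : ℤ) - a).toNat), (j : ℝ) * S (Pi.single i ((j : ℤ) - 1))
              ≤ ∑ j ∈ Finset.range (2 * n), (j : ℝ) * S (Pi.single i ((j : ℤ) - 1)) :=
                Finset.sum_le_sum_of_subset_of_nonneg himage fun j _ _ =>
                  mul_nonneg (Nat.cast_nonneg j) (critS_nonneg _)
            _ ≤ 1 + 2 * ∑ k ∈ Finset.Icc 1 (2 * n), (k : ℝ) * S (Pi.single i (k : ℤ)) :=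
                boundary_sum_le i hn

/-- Bookkeeping of constants in the proof of Theorem 1.3 ("from which the proof follows readily"):
from `c₀ ≤ 2d(S_n χ + (4S_n/n) P (1 + 2K))`, `P ≤ 9^{d-1} n·n^{d-2}` and `s₁ ≤ K` one gets
`c₀ ≤ 2d(1 + 4·9^{d-1}(1/s₁ + 2)) · S_n (χ + n^{d-2} K)`. [cite: DuminilCopinPanis2025LowerBounds, proof of Theorem 1.3, last display] -/
theorem constants_bookkeeping {c₀ Sn χ K s₁ n P D npow d₁ : ℝ} (hSn : 0 ≤ Sn) (hχ : 0 ≤ χ)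
    (hK : 0 ≤ K) (hs₁ : 0 < s₁) (hsK : s₁ ≤ K) (hn : 0 < n) (hd₁ : 0 ≤ d₁) (hD : 0 ≤ D)
    (hnpow : 0 ≤ npow) (hpow : P ≤ D * (n * npow))
    (hstep : c₀ ≤ 2 * d₁ * (Sn * χ + 4 * Sn / n * P * (1 + 2 * K))) :
    c₀ ≤ 2 * d₁ * (1 + 4 * D * (1 / s₁ + 2)) * (Sn * (χ + npow * K)) := by
  have h1 : 1 + 2 * K ≤ (1 / s₁ + 2) * K := by
    rw [add_mul, one_div, inv_mul_eq_div]
    have : 1 ≤ K / s₁ := by rw [le_div_iff₀ hs₁]; linarith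
    linarith
  have h2 : 4 * Sn / n * P * (1 + 2 * K) ≤ 4 * D * (1 / s₁ + 2) * (Sn * (npow * K)) := by
    have hc : 0 ≤ 1 / s₁ + 2 := by positivity
    calc 4 * Sn / n * P * (1 + 2 * K)
        ≤ 4 * Sn / n * (D * (n * npow)) * ((1 / s₁ + 2) * K) :=
          mul_le_mul (mul_le_mul_of_nonneg_left hpow (by positivity)) h1 (by positivity)
            (by positivity)
      _ = 4 * D * (1 / s₁ + 2) * (Sn * (npow * K)) := by
          field_simp
  have h3 : Sn * χ ≤ (1 + 4 * D * (1 / s₁ + 2)) * (Sn * χ) := by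
    have h := mul_nonneg hSn hχ
    have hc : 0 ≤ 4 * D * (1 / s₁ + 2) := by positivity
    nlinarith
  have h4 : 0 ≤ Sn * (npow * K) := by positivity
  calc c₀ ≤ 2 * d₁ * (Sn * χ + 4 * Sn / n * P * (1 + 2 * K)) := hstep
    _ ≤ 2 * d₁ * ((1 + 4 * D * (1 / s₁ + 2)) * (Sn * χ) +
          4 * D * (1 / s₁ + 2) * (Sn * (npow * K))) :=
        mul_le_mul_of_nonneg_left (add_le_add h3 h2) (by positivity)
    _ ≤ 2 * d₁ * (1 + 4 * D * (1 / s₁ + 2)) * (Sn * (χ + npow * K)) := by nlinarith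

/-- **Theorem 1.3 of Duminil-Copin–Panis 2025 at `β_c` from Theorem 1.2 at `β_c`, axis `e_i`**
(the printed proof, p. 5): if `c₀ ≤ ∑_{x,y∈Λ_N, y∼x} (⟨τ₀τ_x⟩ - ⟨τ₀τ_{𝓡_N x}⟩)⟨τ_yτ_{𝓡_N y}⟩`
for all `N ≥ N₀` (Theorem 1.2 at `β_c`), then for `n ≥ max N₀ 1`,
`⟨τ₀τ_{ne_i}⟩_{β_c} ≥ c₁ / (χ_{4n}(β_c) + n^{d-2} ∑_{k≤2n} k⟨τ₀τ_{ke_i}⟩_{β_c})` with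
`c₁ = c₀ / (2d(1 + 4·9^{d-1}(1/⟨τ₀τ_{e_i}⟩_{β_c} + 2)))`. [cite: DuminilCopinPanis2025LowerBounds, Theorem 1.3 and its proof] -/
theorem axis_lower_of_reflectedGradient (hd : 3 ≤ d' + 1) (i : Fin (d' + 1))
    (h12 : ∃ c₀ : ℝ, 0 < c₀ ∧ ∃ N₀ : ℕ, 0 < N₀ ∧ ∀ n : ℕ, N₀ ≤ n →
      c₀ ≤ ∑ x ∈ box (d' + 1) n, ∑ y ∈ box (d' + 1) n,
        if (zdGraph (d' + 1)).Adj x y then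
          (twoPointFree (d' + 1) (criticalBeta (d' + 1)) x -
              twoPointFree (d' + 1) (criticalBeta (d' + 1)) (dcpReflect i (n : ℤ) x)) *
            freeExpect (d' + 1) (criticalBeta (d' + 1)) 0 (spinPair y (dcpReflect i (n : ℤ) y))
        else 0) :
    ∃ c₁ : ℝ, 0 < c₁ ∧ ∃ N₁ : ℕ, 0 < N₁ ∧ ∀ n : ℕ, N₁ ≤ n →
      c₁ / ((∑ x ∈ box (d' + 1) (4 * n), twoPointFree (d' + 1) (criticalBeta (d' + 1)) x) +
            (n : ℝ) ^ (d' + 1 - 2) *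
              ∑ k ∈ Finset.Icc 1 (2 * n),
                (k : ℝ) * twoPointFree (d' + 1) (criticalBeta (d' + 1)) (Pi.single i (k : ℤ)))
        ≤ twoPointFree (d' + 1) (criticalBeta (d' + 1)) (Pi.single i (n : ℤ)) := by
  obtain ⟨c₀, hc₀, N₀, hN₀, hmain⟩ := h12
  -- the constant: `s₁ = ⟨σ₀σ_{e_i}⟩_{β_c} > 0`
  obtain ⟨s₁, hs₁def, hs₁⟩ : ∃ s₁ : ℝ, S (Pi.single i (1 : ℤ)) = s₁ ∧ 0 < s₁ :=
    ⟨_, rfl, by have h := critS_single_pos (by omega) i 1; rwa [Nat.cast_one] at h⟩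
  have hA0 : 0 < 2 * ((d' : ℝ) + 1) * (1 + 4 * 9 ^ d' * (1 / s₁ + 2)) := by positivity
  refine ⟨c₀ / (2 * ((d' : ℝ) + 1) * (1 + 4 * 9 ^ d' * (1 / s₁ + 2))),
    div_pos hc₀ hA0, max N₀ 1, lt_max_of_lt_right one_pos, fun n hn => ?_⟩
  have hnN₀ : N₀ ≤ n := le_of_max_le_left hn
  have hn1 : 1 ≤ n := le_of_max_le_right hn
  have hnpos : (0 : ℝ) < n := by exact_mod_cast hn1
  have hn1' : (1 : ℝ) ≤ n := by exact_mod_cast hn1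
  -- everything in terms of `S = ⟨σ₀σ_·⟩⁺_{β_c}`
  simp only [twoPointFree_criticalBeta_eq hd]
  have hT := hmain (4 * n) (by omega)
  simp only [twoPointFree_criticalBeta_eq hd, freeExpect_spinPair_dcpReflect hd] at hT
  -- nonnegativity of the three quantities
  have hSn0 : 0 ≤ S (Pi.single i (n : ℤ)) := critS_nonneg _
  have hχ0 : 0 ≤ ∑ x ∈ box (d' + 1) (4 * n), S x := Finset.sum_nonneg fun x _ => critS_nonneg _
  have hK0 : 0 ≤ ∑ k ∈ Finset.Icc 1 (2 * n), (k : ℝ) * S (Pi.single i (k : ℤ)) :=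
    Finset.sum_nonneg fun k _ => mul_nonneg (Nat.cast_nonneg k) (critS_nonneg _)
  -- `s₁ ≤ K` (the `k = 1` term)
  have hsK : s₁ ≤ ∑ k ∈ Finset.Icc 1 (2 * n), (k : ℝ) * S (Pi.single i (k : ℤ)) := by
    have h1 : (1 : ℕ) ∈ Finset.Icc 1 (2 * n) := by rw [Finset.mem_Icc]; omega
    have key : ((1 : ℕ) : ℝ) * S (Pi.single i ((1 : ℕ) : ℤ)) ≤
        ∑ k ∈ Finset.Icc 1 (2 * n), (k : ℝ) * S (Pi.single i (k : ℤ)) :=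
      Finset.single_le_sum (f := fun k : ℕ => (k : ℝ) * S (Pi.single i (k : ℤ)))
        (fun k _ => mul_nonneg (Nat.cast_nonneg k) (critS_nonneg _)) h1
    rw [Nat.cast_one, one_mul, Nat.cast_one, hs₁def] at key
    exact key
  -- the main estimate: `c₀ ≤ 2d (Sn χ + (4 Sn / n) (8n+1)^{d'} (1 + 2K))`
  have hrows := fun x (hx : x ∈ box (d' + 1) (4 * n)) => row_sum_le hd i hn1 hx
  have hstep1 : c₀ ≤ 2 * ((d' : ℝ) + 1) *
      (S (Pi.single i (n : ℤ)) * (∑ x ∈ box (d' + 1) (4 * n), S x) +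
        4 * S (Pi.single i (n : ℤ)) / n * ((2 * (4 * n : ℕ) + 1 : ℕ) : ℝ) ^ d' *
          (1 + 2 * ∑ k ∈ Finset.Icc 1 (2 * n), (k : ℝ) * S (Pi.single i (k : ℤ)))) := by
    refine hT.trans ((Finset.sum_le_sum hrows).trans ?_)
    rw [← Finset.mul_sum]
    exact mul_le_mul_of_nonneg_left (sum_majorant_le i hn1) (by positivity)
  -- `(8n+1)^{d'} ≤ 9^{d'} n^{d'} = 9^{d'} n n^{d'-1}`
  have hd' : d' + 1 - 2 = d' - 1 := by omega
  have hpow : ((2 * (4 * n : ℕ) + 1 : ℕ) : ℝ) ^ d' ≤ 9 ^ d' * ((n : ℝ) * (n : ℝ) ^ (d' - 1)) := by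
    rw [← pow_succ', Nat.sub_add_cancel (by omega : 1 ≤ d'), ← mul_pow]
    exact pow_le_pow_left₀ (by positivity) (by push_cast; linarith) d'
  have key := constants_bookkeeping hSn0 hχ0 hK0 hs₁ hsK hnpos (by positivity) (by positivity)
    (by positivity) hpow hstep1
  -- conclude
  have hD : 0 < (∑ x ∈ box (d' + 1) (4 * n), S x) +
      (n : ℝ) ^ (d' - 1) * ∑ k ∈ Finset.Icc 1 (2 * n), (k : ℝ) * S (Pi.single i (k : ℤ)) := by
    have h0 : (1 : ℝ) ≤ ∑ x ∈ box (d' + 1) (4 * n), S x := by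
      have key : S 0 ≤ ∑ x ∈ box (d' + 1) (4 * n), S x :=
        Finset.single_le_sum (f := fun x : Site (d' + 1) => S x) (fun x _ => critS_nonneg x)
          (zero_mem_box (d' + 1) (4 * n))
      rw [twoPointPlus_origin] at key
      exact key
    have h1 : 0 ≤ (n : ℝ) ^ (d' - 1) * ∑ k ∈ Finset.Icc 1 (2 * n), (k : ℝ) * S (Pi.single i (k : ℤ)) :=
      mul_nonneg (pow_nonneg hnpos.le _) hK0
    linarith
  rw [hd', div_le_iff₀ hD, div_le_iff₀ hA0]
  calc c₀ ≤ _ := key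
    _ = _ := by ring

end Critical

end DCP

/-- **Duminil-Copin–Panis 2025, Theorem 1.3 at `β_c`, from Theorem 1.2 at `β_c` — the printed
deduction, proved.** For `d ≥ 3`: if `dcp_reflectedGradient_lower` (Theorem 1.2 at `β_c`) holds
then `dcp_criticalTwoPoint_axis_lower` (Theorem 1.3 at `β_c`) holds:
`⟨τ₀τ_{ne₁}⟩_{β_c} ≥ c₁ / (χ_{4n}(β_c) + n^{d-2} ∑_{1≤k≤2n} k⟨τ₀τ_{ke₁}⟩_{β_c})` for `n ≥ N₁`. Inputs:
MMS, `μ⁺_{β_c} = μ^f_{β_c}` and `m*(β_c) = 0` (ADS 2015), and the gradient estimate proved in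
this file from the log-convexity of the two-point function along an axis (spectral
representation). The remaining hypothesis, Theorem 1.2, is the random-current reflected-switching
inequality of §2 of the source. [cite: DuminilCopinPanis2025LowerBounds, Theorem 1.3 (proof from Theorem 1.2, p. 5)] -/
theorem dcp_criticalTwoPoint_axis_lower_of_reflectedGradient_lower {d : ℕ}
    (h : dcp_reflectedGradient_lower (d := d)) : dcp_criticalTwoPoint_axis_lower (d := d) := by
  intro hd
  obtain ⟨d', rfl⟩ : ∃ d', d = d' + 1 := ⟨d - 1, by omega⟩
  exact DCP.axis_lower_of_reflectedGradient hd _ (h hd)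

end Literature.Probability.LatticeModels
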